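import Summits.Ventures.PercRepro.S1CircuitLadderA

/-!
# PercRepro — THE CIRCUIT LADDER AT BOUNDED NULLITY, PART B (the rungs `4` and `5`): `2·s₂ ≤ a·ν`, `4·s₃ ≤ a·ν(ν+1)`, `12·s₄ ≤ a·ν(ν+1)(ν+2)`,
`48·s₅ ≤ a·ν(ν+1)(ν+2)(ν+3)` under a flat bound ONE RANK BELOW (p8, gen 18; a feeder for S4 — the top of the `q = 7` window)

p2 g14's LEMMAS T and T4 (`two_mul_ncard_triangles_le`, `three_mul_ncard_four_circuits_le`) with the point bounds as
PARAMETERS: if every set of rank `≤ k − 1` has at most `a + (k − 2)` points and `|E| = r(E) + ν`, then the `k`-element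
circuits number at most `a·ν(ν+1)⋯(ν+k−2)/(k−1)!` — for `k = 2, 3, 4, 5`. The proof is p2's, one rung per size: the
`k`-circuits through a non-loop `e` inject (`C ↦ C ∖ {e}`) into the `(k − 1)`-circuits of `M ／ {e}`, whose rank-`≤ k − 2`
sets have at most `a + (k − 3)` points (one point fewer than the rank-`≤ k − 1` sets of `M` through `e`), and the
`k`-circuits avoiding `e` are those of `M ＼ {e}` (nullity `ν − 1`); the base is the parallel-pair count (a class of
`c + 1 ≤ a` points carries `C(c + 1, 2) ≤ a·c/2` pairs and `c` of the nullity).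
At level `7` the `e`-free core has rank-`4` sets of `≤ 10` points, so `48·s₅ ≤ 7·ν(ν+1)(ν+2)(ν+3)` (LEMMA T5) — against
`s₅ ≤ C(ν + 4, 5)`: `206 168` against `435 897` at `ν = 33`, the cell `(70, 33)` of the quartic chain.
* **`two_mul_ncard_two_circuits_le`** (rank-`1` sets `≤ a`) · **`two_mul_ncard_trianglesThrough_le`**,
  **`four_mul_ncard_triangles_le`** (rank-`2` sets `≤ a + 1`) · **`four_mul_ncard_fourThrough_le`**,
  **`twelve_mul_ncard_four_circuits_le`** (rank-`3` sets `≤ a + 2`) · **`twelve_mul_ncard_fiveThrough_le`**,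
  **`fortyEight_mul_ncard_five_circuits_le`** (rank-`4` sets `≤ a + 3`).
Axioms: standard.
-/

open scoped Matroid

namespace PercRepro

namespace S1

open Set

variable {α : Type}

/-- **The `4`-circuit count at bounded nullity, the rank-`3` sets with `≤ a + 2` points**: `12·s_4 ≤ a * d * (d + 1) * (d + 2)`
(the deletion induction of Lemma T: the `4`-circuits through a point `e` by `four_mul_ncard_fourThrough_le`, the others are the
`4`-circuits of `M ＼ {e}`). -/
theorem twelve_mul_ncard_four_circuits_le (M : Matroid α) [M.Finite] (a : ℕ)
    (hflat : ∀ X ⊆ M.E, M.eRk X ≤ 3 → X.ncard ≤ a + 2) {d : ℕ} (hd : M.E.encard = M.eRank + d) :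
    12 * {C : Set α | M.IsCircuit C ∧ C.ncard = 4}.ncard ≤ a * d * (d + 1) * (d + 2) := by
  suffices H : ∀ n : ℕ, ∀ (M : Matroid α) [M.Finite], M.E.ncard = n →
      (∀ X ⊆ M.E, M.eRk X ≤ 3 → X.ncard ≤ a + 2) → ∀ d : ℕ, M.E.encard = M.eRank + d →
      12 * {C : Set α | M.IsCircuit C ∧ C.ncard = 4}.ncard ≤ a * d * (d + 1) * (d + 2) from H _ M rfl hflat d hd
  intro n
  induction n using Nat.strong_induction_on with
  | _ n ih =>
  intro M _ hn hflat d hd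
  classical
  set S := {C : Set α | M.IsCircuit C ∧ C.ncard = 4} with hS
  have hSfin : S.Finite :=
    M.ground_finite.finite_subsets.subset (fun C hC => hC.1.subset_ground)
  by_cases hSe : S = ∅
  · rw [hSe, ncard_empty]; exact Nat.zero_le _
  obtain ⟨C₀, hC₀⟩ := nonempty_iff_ne_empty.2 hSe
  obtain ⟨e, heC₀⟩ := hC₀.1.nonempty
  have heE : e ∈ M.E := hC₀.1.subset_ground heC₀
  have hne : ¬ M.IsColoop e := hC₀.1.not_isColoop_of_mem heC₀
  have hν : M✶.eRank = (d : ℕ∞) := dual_eRank_eq_of_encard M hd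
  have hdel := PercRepro.Matroid.dual_eRank_delete_singleton_add_one heE hne
  rw [hν] at hdel
  have hfin' : (M ＼ {e})✶.eRank ≠ ⊤ := by
    intro h
    rw [h] at hdel
    exact absurd hdel (by simp)
  obtain ⟨d', hd'⟩ := ENat.ne_top_iff_exists.1 hfin'
  have hdd' : d = d' + 1 := by
    rw [← hd'] at hdel
    exact_mod_cast hdel.symm
  have hd'enc : (M ＼ {e}).E.encard = (M ＼ {e}).eRank + d' := encard_eq_of_dual_eRank _ hd'.symm
  have hdelE : (M ＼ {e}).E.ncard < n := by
    rw [_root_.Matroid.delete_ground, ← hn, ← ncard_sdiff_singleton_add_one heE M.ground_finite]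
    omega
  have hflat' : ∀ X ⊆ (M ＼ {e}).E, (M ＼ {e}).eRk X ≤ 3 → X.ncard ≤ a + 2 := by
    intro X hX hr
    rw [_root_.Matroid.delete_ground] at hX
    rw [delete_singleton_eRk_eq hX] at hr
    exact hflat X (hX.trans sdiff_subset) hr
  have heI : M.Indep {e} := by
    rw [_root_.Matroid.indep_singleton, ← _root_.Matroid.not_isLoop_iff heE]
    intro hloop
    have hC₀e : C₀ = {e} := hloop.eq_of_isCircuit_mem hC₀.1 heC₀
    have := hC₀.2
    rw [hC₀e, ncard_singleton] at this
    omega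
  set S₁ := {C : Set α | M.IsCircuit C ∧ C.ncard = 4 ∧ e ∈ C} with hS₁
  set S₂ := {C : Set α | M.IsCircuit C ∧ C.ncard = 4 ∧ e ∉ C} with hS₂
  have hsplit : S ⊆ S₁ ∪ S₂ := by
    intro C hC
    by_cases h : e ∈ C
    · exact Or.inl ⟨hC.1, hC.2, h⟩
    · exact Or.inr ⟨hC.1, hC.2, h⟩
  have hS₁fin : S₁.Finite := hSfin.subset (fun C hC => ⟨hC.1, hC.2.1⟩)
  have hS₂fin : S₂.Finite := hSfin.subset (fun C hC => ⟨hC.1, hC.2.1⟩)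
  have h1 : 4 * S₁.ncard ≤ a * d * (d + 1) := four_mul_ncard_fourThrough_le M a hflat heI hd
  have h2c : 12 * S₂.ncard ≤ a * d' * (d' + 1) * (d' + 2) := by
    have hsub : S₂ ⊆ {C : Set α | (M ＼ {e}).IsCircuit C ∧ C.ncard = 4} := by
      intro C hC
      exact ⟨_root_.Matroid.delete_isCircuit_iff.2 ⟨hC.1, disjoint_singleton_right.2 hC.2.2⟩, hC.2.1⟩
    calc 12 * S₂.ncard ≤ 12 * {C : Set α | (M ＼ {e}).IsCircuit C ∧ C.ncard = 4}.ncard := by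
          apply Nat.mul_le_mul_left
          exact ncard_le_ncard hsub
            ((M ＼ {e}).ground_finite.finite_subsets.subset (fun C hC => hC.1.subset_ground))
      _ ≤ _ := ih _ hdelE (M ＼ {e}) rfl hflat' d' hd'enc
  have h3 : S.ncard ≤ S₁.ncard + S₂.ncard :=
    (ncard_le_ncard hsplit (hS₁fin.union hS₂fin)).trans (ncard_union_le _ _)
  subst hdd'
  nlinarith [h1, h2c, h3]

/-- **The `5`-circuits through a point, the rank-`4` sets with `≤ a + 3` points**: `12·#{5-circuits through e} ≤ a * d * (d + 1) * (d + 2)` —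
they inject (`C ↦ C ∖ {e}`) into the `4`-circuits of `M ／ {e}`, whose rank-`≤ 3` sets have `≤ a + 2` points (the four-circuit count one rung down). -/
theorem twelve_mul_ncard_fiveThrough_le (M : Matroid α) [M.Finite] (a : ℕ)
    (hflat : ∀ X ⊆ M.E, M.eRk X ≤ 4 → X.ncard ≤ a + 3) {e : α} (heI : M.Indep {e}) {d : ℕ}
    (hd : M.E.encard = M.eRank + d) :
    12 * {C : Set α | M.IsCircuit C ∧ C.ncard = 5 ∧ e ∈ C}.ncard ≤ a * d * (d + 1) * (d + 2) := by
  classical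
  have heE : e ∈ M.E := heI.subset_ground (mem_singleton e)
  have hν : M✶.eRank = (d : ℕ∞) := dual_eRank_eq_of_encard M hd
  set N := M ／ {e} with hN
  have hNd : N.E.encard = N.eRank + d := by
    apply encard_eq_of_dual_eRank
    rw [hN, PercRepro.Matroid.dual_eRank_contract_singleton heI, hν]
  have hNE : N.E = M.E \ {e} := _root_.Matroid.contract_ground M {e}
  have hN' : ∀ L ⊆ N.E, N.eRk L ≤ 3 → L.ncard ≤ a + 2 := by
    intro L hL hr
    rw [hNE] at hL
    have heL : e ∉ L := fun h => (hL h).2 rfl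
    have hLfin : L.Finite := M.ground_finite.subset (hL.trans sdiff_subset)
    have hins : M.eRk (insert e L) ≤ 4 := by
      have h := contract_singleton_eRk_add_one heI hL
      rw [← hN] at h
      rw [← h]
      calc N.eRk L + 1 ≤ 3 + 1 := add_le_add_left hr 1
        _ = 4 := by norm_num
    have hb := hflat (insert e L) (insert_subset heE (hL.trans sdiff_subset)) hins
    rw [ncard_insert_of_notMem heL hLfin] at hb
    omega
  set S₁ := {C : Set α | M.IsCircuit C ∧ C.ncard = 5 ∧ e ∈ C} with hS₁
  let f : Set α → Set α := fun C => C \ {e}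
  have hmaps : ∀ C ∈ S₁, f C ∈ {C' : Set α | N.IsCircuit C' ∧ C'.ncard = 4} := by
    intro C hC
    have hCfin : C.Finite := M.ground_finite.subset hC.1.subset_ground
    refine ⟨hC.1.contractElem_isCircuit ?_ hC.2.2, ?_⟩
    · have h1lt : 1 < C.ncard := by rw [hC.2.1]; omega
      obtain ⟨x, hx, y, hy, hxy⟩ := (one_lt_ncard hCfin).1 h1lt
      exact ⟨x, hx, y, hy, hxy⟩
    · have h3 := ncard_sdiff_singleton_add_one hC.2.2 hCfin
      have h4 := hC.2.1
      simp only [f]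
      omega
  have hinj : InjOn f S₁ := by
    intro C hC C' hC' h
    have e1 : C = insert e (C \ {e}) := by rw [insert_sdiff_singleton, insert_eq_of_mem hC.2.2]
    have e2 : C' = insert e (C' \ {e}) := by rw [insert_sdiff_singleton, insert_eq_of_mem hC'.2.2]
    rw [e1, e2]
    simp only [f] at h
    rw [h]
  have hle : S₁.ncard ≤ {C' : Set α | N.IsCircuit C' ∧ C'.ncard = 4}.ncard :=
    ncard_le_ncard_of_injOn f hmaps hinj
      (N.ground_finite.finite_subsets.subset (fun C hC => hC.1.subset_ground))
  have hinner := twelve_mul_ncard_four_circuits_le N a hN' hNd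
  calc 12 * S₁.ncard ≤ 12 * {C' : Set α | N.IsCircuit C' ∧ C'.ncard = 4}.ncard := Nat.mul_le_mul_left _ hle
    _ ≤ a * d * (d + 1) * (d + 2) := hinner

/-- **The `5`-circuit count at bounded nullity, the rank-`4` sets with `≤ a + 3` points**: `48·s_5 ≤ a * d * (d + 1) * (d + 2) * (d + 3)`
(the deletion induction of Lemma T: the `5`-circuits through a point `e` by `twelve_mul_ncard_fiveThrough_le`, the others are the
`5`-circuits of `M ＼ {e}`). -/
theorem fortyEight_mul_ncard_five_circuits_le (M : Matroid α) [M.Finite] (a : ℕ)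
    (hflat : ∀ X ⊆ M.E, M.eRk X ≤ 4 → X.ncard ≤ a + 3) {d : ℕ} (hd : M.E.encard = M.eRank + d) :
    48 * {C : Set α | M.IsCircuit C ∧ C.ncard = 5}.ncard ≤ a * d * (d + 1) * (d + 2) * (d + 3) := by
  suffices H : ∀ n : ℕ, ∀ (M : Matroid α) [M.Finite], M.E.ncard = n →
      (∀ X ⊆ M.E, M.eRk X ≤ 4 → X.ncard ≤ a + 3) → ∀ d : ℕ, M.E.encard = M.eRank + d →
      48 * {C : Set α | M.IsCircuit C ∧ C.ncard = 5}.ncard ≤ a * d * (d + 1) * (d + 2) * (d + 3) from H _ M rfl hflat d hd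
  intro n
  induction n using Nat.strong_induction_on with
  | _ n ih =>
  intro M _ hn hflat d hd
  classical
  set S := {C : Set α | M.IsCircuit C ∧ C.ncard = 5} with hS
  have hSfin : S.Finite :=
    M.ground_finite.finite_subsets.subset (fun C hC => hC.1.subset_ground)
  by_cases hSe : S = ∅
  · rw [hSe, ncard_empty]; exact Nat.zero_le _
  obtain ⟨C₀, hC₀⟩ := nonempty_iff_ne_empty.2 hSe
  obtain ⟨e, heC₀⟩ := hC₀.1.nonempty
  have heE : e ∈ M.E := hC₀.1.subset_ground heC₀
  have hne : ¬ M.IsColoop e := hC₀.1.not_isColoop_of_mem heC₀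
  have hν : M✶.eRank = (d : ℕ∞) := dual_eRank_eq_of_encard M hd
  have hdel := PercRepro.Matroid.dual_eRank_delete_singleton_add_one heE hne
  rw [hν] at hdel
  have hfin' : (M ＼ {e})✶.eRank ≠ ⊤ := by
    intro h
    rw [h] at hdel
    exact absurd hdel (by simp)
  obtain ⟨d', hd'⟩ := ENat.ne_top_iff_exists.1 hfin'
  have hdd' : d = d' + 1 := by
    rw [← hd'] at hdel
    exact_mod_cast hdel.symm
  have hd'enc : (M ＼ {e}).E.encard = (M ＼ {e}).eRank + d' := encard_eq_of_dual_eRank _ hd'.symm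
  have hdelE : (M ＼ {e}).E.ncard < n := by
    rw [_root_.Matroid.delete_ground, ← hn, ← ncard_sdiff_singleton_add_one heE M.ground_finite]
    omega
  have hflat' : ∀ X ⊆ (M ＼ {e}).E, (M ＼ {e}).eRk X ≤ 4 → X.ncard ≤ a + 3 := by
    intro X hX hr
    rw [_root_.Matroid.delete_ground] at hX
    rw [delete_singleton_eRk_eq hX] at hr
    exact hflat X (hX.trans sdiff_subset) hr
  have heI : M.Indep {e} := by
    rw [_root_.Matroid.indep_singleton, ← _root_.Matroid.not_isLoop_iff heE]
    intro hloop
    have hC₀e : C₀ = {e} := hloop.eq_of_isCircuit_mem hC₀.1 heC₀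
    have := hC₀.2
    rw [hC₀e, ncard_singleton] at this
    omega
  set S₁ := {C : Set α | M.IsCircuit C ∧ C.ncard = 5 ∧ e ∈ C} with hS₁
  set S₂ := {C : Set α | M.IsCircuit C ∧ C.ncard = 5 ∧ e ∉ C} with hS₂
  have hsplit : S ⊆ S₁ ∪ S₂ := by
    intro C hC
    by_cases h : e ∈ C
    · exact Or.inl ⟨hC.1, hC.2, h⟩
    · exact Or.inr ⟨hC.1, hC.2, h⟩
  have hS₁fin : S₁.Finite := hSfin.subset (fun C hC => ⟨hC.1, hC.2.1⟩)
  have hS₂fin : S₂.Finite := hSfin.subset (fun C hC => ⟨hC.1, hC.2.1⟩)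
  have h1 : 12 * S₁.ncard ≤ a * d * (d + 1) * (d + 2) := twelve_mul_ncard_fiveThrough_le M a hflat heI hd
  have h2c : 48 * S₂.ncard ≤ a * d' * (d' + 1) * (d' + 2) * (d' + 3) := by
    have hsub : S₂ ⊆ {C : Set α | (M ＼ {e}).IsCircuit C ∧ C.ncard = 5} := by
      intro C hC
      exact ⟨_root_.Matroid.delete_isCircuit_iff.2 ⟨hC.1, disjoint_singleton_right.2 hC.2.2⟩, hC.2.1⟩
    calc 48 * S₂.ncard ≤ 48 * {C : Set α | (M ＼ {e}).IsCircuit C ∧ C.ncard = 5}.ncard := by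
          apply Nat.mul_le_mul_left
          exact ncard_le_ncard hsub
            ((M ＼ {e}).ground_finite.finite_subsets.subset (fun C hC => hC.1.subset_ground))
      _ ≤ _ := ih _ hdelE (M ＼ {e}) rfl hflat' d' hd'enc
  have h3 : S.ncard ≤ S₁.ncard + S₂.ncard :=
    (ncard_le_ncard hsplit (hS₁fin.union hS₂fin)).trans (ncard_union_le _ _)
  subst hdd'
  nlinarith [h1, h2c, h3]

end S1

end PercRepro
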